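import Summits.ResolutionOfSingularities.ResolutionOfSingularities.Theorems.HomologicalConductorNoZenoSandwichClusterDefs
import Summits.ResolutionOfSingularities.ResolutionOfSingularities.Theorems.HomologicalConductorNoZenoBasePtsFinite
import Summits.ResolutionOfSingularities.ResolutionOfSingularities.Theorems.HomologicalConductorNoZenoBasePtsStrictAnti
import Summits.ResolutionOfSingularities.ResolutionOfSingularities.Theorems.HomologicalConductorNoZenoRegularOfBasePtsEmpty
import Summits.ResolutionOfSingularities.ResolutionOfSingularities.Theorems.HomologicalConductorNoZenoCaPrincipalReductions
import Summits.ResolutionOfSingularities.ResolutionOfSingularities.Theorems.HomologicalConductorNoZenoCaPrincipalSky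
import Summits.ResolutionOfSingularities.ResolutionOfSingularities.Theorems.HomologicalConductorNoZenoSkyBridge
import Summits.ResolutionOfSingularities.ResolutionOfSingularities.Theorems.HomologicalConductorNoZenoMinResolutionExists
import Summits.ResolutionOfSingularities.ResolutionOfSingularities.Theorems.HomologicalConductorNoZenoSkyPointLifts
import Summits.ResolutionOfSingularities.ResolutionOfSingularities.Theorems.HomologicalConductorNoZenoCaInvertibleMinRes
import Summits.ResolutionOfSingularities.ResolutionOfSingularities.Theorems.HomologicalConductorNoZenoExhaustionSandwich
import Summits.ResolutionOfSingularities.ResolutionOfSingularities.Theorems.HomologicalConductorNoZenoSurfaceLU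
import Summits.ResolutionOfSingularities.ResolutionOfSingularities.Theorems.HomologicalConductorNoZenoExhaustionExcludesTermination
import Summits.ResolutionOfSingularities.ResolutionOfSingularities.Theorems.HomologicalConductorPersistenceRadical
import Literature.AlgebraicGeometry.Resolution.QuasiExcellentSchemes
import Literature.AlgebraicGeometry.Resolution.Lipman1969RationalSurfaceSingularities
import Literature.AlgebraicGeometry.Resolution.Lipman1969FormallySmoothBaseChange
import Literature.AlgebraicGeometry.Resolution.Lipman1969RationalContraction
import Literature.AlgebraicGeometry.Morphisms.CechH2FibreDimOne
import HarnessLib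

/-!
# Kill test `SurfaceTermination` (stmt-ResolutionOfSingularities-16488) / crux `NoZenoR` (stmt-19943):
# THE RANK-ONE NON-DISCRETE ZERO-DIMENSIONAL SURFACE KERNEL IS SETTLED — WITHOUT `StrictDrop`, modulo the six printed surface facts

OURS (cell res-hironaka, crux chain W4.4; lead res-L0-w44-lead-1 g10, DESK WORD 47 OBJECT 4-B, part 1).  AI-written, weaker than expert review;
nothing here is a statement of the manuscript under review (Hironaka 2017).  SUPPORT-level, counted 0.  Def-free.  TREE PORT of the
sandwich-cluster COMPOSITIONS of the crux registry `NoZeno-v33-close5.lean` (HOME `L/res-L0-w44-lead-1/`, ll. 2541–2821: planner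
res-L0-w44-plan-1's line `sandwich-cluster`, stubs S1–S4 / GE / G4′ / P1.3′ all LANDED by stub-1/2/3/4/5/6/8/9 and the lead g4–g8), whose
statements so far lived only in the registry skeleton: here they become tree theorems with the `Sig.*` texts written out.

THE POINT FOR THE KILL TEST (desk DW47): in the registry's composition the surface rank-one kernel `Sig.stub_kernelRankOneSurface` carries the
route binders `PersistenceRadical → StrictDrop →` but its derivation `kernelRankOneSurface_of_sandwich` NEVER USES THEM.  Hence:

* `skyPrincipal`, `caPrincipalUpstairsCore`, `caPrincipalUpstairs` («THEOREM A at sky points» ⇒ (Q_val)), `sandwichedTerminationCore`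
  (strong induction on the number of base points: S1 finiteness, S2 regularity, S3 principality, S4 strict decrease) — modulo the facts
  `CossartJannsenSaito2020General ∧ Lipman1969_1_2 ∧ Lipman1969_4_1 ∧ Lipman1969_12_1_i ∧ Lipman1969_12_1_ii ∧ GortzWedhorn2023_24_44_H2`;
* **`kernelRankOneSurface_terminates`** — the v6 surface kernel text WITHOUT `PersistenceRadical`/`StrictDrop`: a rank-one, exhausting,
  zero-dimensional kernel tower of a SURFACE datum terminates (surface LU from CJS + the sandwich supply `exh_exists_regular_le_tower_of_isLocallyUniformizable`);
* **`no_kernelRankOneSurface`** — with 2-Z (`Exhaustion.not_isRegularLocalRing_of_exhaustive`) the honest reading: modulo the six facts there is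
  NO such datum — every surface tower along a rank-one valuation ring is weakly dominated by a NOETHERIAN valuation ring (or fails maximality).
  So the `StrictDrop`-dependence of `SurfaceTermination` (part 2, `…SurfaceTerminationOfStrictDrop`) sits ENTIRELY in the noetherian-dominator
  case (`stub_noetherianCase`) and the rank-two composite case (`stub_relativeACC`) — the director's «divisorial valuations of surfaces».

References: J. Lipman, Publ. IHÉS 36 (1969) [`Lipman1969`]; M. Spivakovsky, Ann. Math. 131 (1990) §II [`Spivakovsky1990`]; O. Zariski,
P. Samuel, *Commutative Algebra* II, App. 5 [`ZariskiSamuel1960`]; V. Cossart, U. Jannsen, S. Saito, LNM 2270 (2020) Thm 1.2 [`CossartJannsenSaito2020`].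
-/

noncomputable section

-- single-problem summit: the doubled namespace component `ResolutionOfSingularities` is forced
set_option linter.dupNamespace false

namespace Summit.ResolutionOfSingularities.ResolutionOfSingularities.Theorems.SurfaceTermination.SandwichKernel

open Summit.ResolutionOfSingularities.ResolutionOfSingularities.Theses.HomologicalConductor
open Summit.ResolutionOfSingularities.ResolutionOfSingularities.Theorems.NoZeno.Birth
open Summit.ResolutionOfSingularities.ResolutionOfSingularities.Theorems.NoZeno.SandwichCluster
open Summit.ResolutionOfSingularities.ResolutionOfSingularities.Theorems
open Summit.ResolutionOfSingularities.ResolutionOfSingularities.Theorems.NoZeno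
open Literature.AlgebraicGeometry.Resolution Literature.AlgebraicGeometry.Morphisms
open IsLocalRing CategoryTheory AlgebraicGeometry

variable {k K : Type} [Field k] [Field K] [Algebra k K]

/-! ## Two scheme-side trivialities (registry ll. 2591–2609) -/

/-- A minimal resolution of the spectrum of a stage is an INTEGRAL scheme. [folklore] -/
theorem isIntegral_of_isMinimalResolution (T : Subalgebra k K)
    {X : AlgebraicGeometry.Scheme.{0}} {π : X ⟶ AlgebraicGeometry.Spec (CommRingCat.of ↥T)}
    (hπ : IsMinimalResolution π) : AlgebraicGeometry.IsIntegral X := by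
  haveI : AlgebraicGeometry.IsReduced X := hπ.1.isRegular.isReduced
  exact hπ.1.isBirational.isIntegral

/-- The registry's ideal `Ideal.span {s : S | (s : K) ∈ ca T}` is the extension of `cohomologyAnnihilator ↥T` along `T ↪ S`. [folklore] -/
theorem span_ca_eq_map_inclusion (T S : Subalgebra k K) (hTS : T ≤ S) :
    Ideal.span {s : ↥S | (s : K) ∈ ca T} =
      Ideal.map (Subalgebra.inclusion hTS).toRingHom
        (Literature.RingTheory.CohomologyAnnihilator.cohomologyAnnihilator ↥T) := by
  have hset : {s : ↥S | (s : K) ∈ ca T} = (Subalgebra.inclusion hTS) ''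
      (Literature.RingTheory.CohomologyAnnihilator.cohomologyAnnihilator ↥T : Set ↥T) := by
    ext s
    rw [Set.mem_setOf_eq, Theorems.HomologicalConductor.PersistenceRadical.ca_eq_image]
    constructor
    · rintro ⟨t, ht, hts⟩
      exact ⟨t, ht, Subtype.ext (by simpa using hts)⟩
    · rintro ⟨t, ht, rfl⟩
      exact ⟨t, ht, rfl⟩
  rw [hset, Ideal.map]
  rfl

/-! ## THEOREM A at sky points ⇒ (Q_val) (registry ll. 2686–2762, hypotheses discharged by the landed stubs) -/

/-- **THEOREM A AT SKY POINTS (`Sig.stub_skyPrincipal`, PROVED modulo the six facts).**  For a SINGULAR sandwiched stage `T_m` and a sky point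
`S` of `T_m`, the ideal of `S` generated by `ca(T_m)` is principal: GE (`stub_minResolutionExists`, p502369) gives the minimal resolution,
P1.3′ (`stub_skyPointLifts`, p504303) lifts the sky point into it, G4′ (`stub_caInvertibleMinRes`, THEOREM A) gives principality at the
lifted closed-fibre point, and the bridge (`isPrincipal_map_inclusion_of_lift`, p499137) carries it to `S`. [OURS; registry `skyPrincipal_of_G`] -/
theorem skyPrincipal (hF : (Literature.AlgebraicGeometry.Resolution.CossartJannsenSaito2020General.{0} ∧ Literature.AlgebraicGeometry.Resolution.Lipman1969_1_2.{0} ∧ Literature.AlgebraicGeometry.Resolution.Lipman1969_4_1.{0} ∧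
    Literature.AlgebraicGeometry.Resolution.Lipman1969_12_1_i.{0} ∧ Literature.AlgebraicGeometry.Resolution.Lipman1969_12_1_ii.{0} ∧
    Literature.AlgebraicGeometry.Morphisms.GortzWedhorn2023_24_44_H2.{0})) :
    ∀ p : ℕ, p.Prime → ∀ (k K : Type) [Field k] [CharP k p] [Field K] [Algebra k K]
      (O : ValuationSubring K) (A R : Subalgebra k K) (m₀ : ℕ), SandwichCtx O A R m₀ →
      ∀ m : ℕ, m₀ + 1 ≤ m → ¬ IsRegularLocalRing ↥(tower O A m) →
      ∀ S : Subalgebra k K, tower O A m ≤ S → IsRegularLocalRing ↥S → ringKrullDim ↥S = 2 →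
        (∀ t : K, t ∈ tower O A m → t⁻¹ ∈ S → t⁻¹ ∈ tower O A m) →
        Literature.AlgebraicGeometry.Resolution.SubringDominates R.toSubring S.toSubring →
        (∃ Q : Subring K,
          Relation.ReflTransGen Literature.AlgebraicGeometry.Resolution.IsQuadraticTransform R.toSubring Q ∧
          Literature.AlgebraicGeometry.Resolution.IsQuadraticTransform Q S.toSubring ∧
          ¬ (tower O A m).toSubring ≤ Q) →
        (Ideal.span {s : ↥S | (s : K) ∈ ca (tower O A m)}).IsPrincipal := by
  intro p hp k K _ _ _ _ O A R m₀ ctx m hm hsing S hTS hS hS2 hdom hdomR hsky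
  obtain ⟨hCJS, h12, h41, h121i, h121ii, hGW⟩ := hF
  obtain ⟨X, π, hπ⟩ := stub_minResolutionExists hCJS h12 h41 p hp k K O A R m₀ ctx m hm hsing
  obtain ⟨l, hl⟩ := stub_skyPointLifts hCJS p hp k K O A R m₀ ctx m hm hsing S hTS hS hS2 hdom hdomR hsky X π hπ
  haveI : IsLocalRing ↥S := inferInstance
  rw [span_ca_eq_map_inclusion (tower O A m) S hTS]
  refine isPrincipal_map_inclusion_of_lift (tower O A m) S hTS π l hl ?_
  refine stub_caInvertibleMinRes ⟨hCJS, h12, h41, h121i, h121ii, hGW⟩ p hp k K O A R m₀ ctx m hm hsing X π hπ _ ?_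
  haveI hloc := isLocalHom_inclusion_of_dominates hTS hdom
  refine ⟨fun t ht => ?_⟩
  have hcomp := stalkClosedPointTo_germ_appTop π (Subalgebra.inclusion hTS).toRingHom l hl t
  have hu : IsUnit ((Subalgebra.inclusion hTS).toRingHom t) := by
    rw [← hcomp]
    exact ht.map _
  exact hloc.map_nonunit t hu

/-- **S3core (`Sig.stub_caPrincipalUpstairsCore`) from THEOREM A at sky points** (stub-3's sky-point reduction `caPrincipalUpstairs_of_skyPoints`,
p489646; the branch `S = R` is contradictory at a singular stage). [OURS; registry `caPrincipalUpstairsCore_of_skyPrincipal`] -/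
theorem caPrincipalUpstairsCore (hF : (Literature.AlgebraicGeometry.Resolution.CossartJannsenSaito2020General.{0} ∧ Literature.AlgebraicGeometry.Resolution.Lipman1969_1_2.{0} ∧ Literature.AlgebraicGeometry.Resolution.Lipman1969_4_1.{0} ∧
    Literature.AlgebraicGeometry.Resolution.Lipman1969_12_1_i.{0} ∧ Literature.AlgebraicGeometry.Resolution.Lipman1969_12_1_ii.{0} ∧
    Literature.AlgebraicGeometry.Morphisms.GortzWedhorn2023_24_44_H2.{0})) :
    ∀ p : ℕ, p.Prime → ∀ (k K : Type) [Field k] [CharP k p] [Field K] [Algebra k K]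
      (O : ValuationSubring K) (A R : Subalgebra k K) (m₀ : ℕ), SandwichCtx O A R m₀ →
      ∀ m : ℕ, m₀ + 1 ≤ m → ¬ IsRegularLocalRing ↥(tower O A m) →
      ∀ S : Subalgebra k K, tower O A m ≤ S → IsRegularLocalRing ↥S →
        (∀ t : K, t ∈ tower O A m → t⁻¹ ∈ S → t⁻¹ ∈ tower O A m) →
        (Ideal.span {s : ↥S | (s : K) ∈ ca (tower O A m)}).IsPrincipal := by
  intro p hp k K _ _ _ _ O A R m₀ ctx m hm hsing S hTS hS _hdom
  refine caPrincipalUpstairs_of_skyPoints p hp k K O A R m₀ ctx m hm ?_ S hTS hS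
  intro S' hTS' hS' hS2' hdom' hdomR' hsky'
  rcases hsky' with hR | hQ
  · exfalso
    have hRT : R ≤ tower O A m := ctx.2.2.2.2.2.2.2.2.2 m (by omega)
    have hTR : tower O A m ≤ R := hR ▸ hTS'
    exact hsing (le_antisymm hTR hRT ▸ ctx.2.2.2.2.2.1)
  · exact skyPrincipal hF p hp k K O A R m₀ ctx m hm hsing S' hTS' hS' hS2' hdom' hdomR' hQ

/-- **S3 (`Sig.stub_caPrincipalUpstairs` = (Q_val)) from S3core** by the Layer-0 reductions (`span_ca_eq_top_of_isRegularLocalRing`,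
`isPrincipal_span_ca_of_not_dominates`, p488997). [OURS; registry `caPrincipalUpstairs_of_core`] -/
theorem caPrincipalUpstairs (hF : (Literature.AlgebraicGeometry.Resolution.CossartJannsenSaito2020General.{0} ∧ Literature.AlgebraicGeometry.Resolution.Lipman1969_1_2.{0} ∧ Literature.AlgebraicGeometry.Resolution.Lipman1969_4_1.{0} ∧
    Literature.AlgebraicGeometry.Resolution.Lipman1969_12_1_i.{0} ∧ Literature.AlgebraicGeometry.Resolution.Lipman1969_12_1_ii.{0} ∧
    Literature.AlgebraicGeometry.Morphisms.GortzWedhorn2023_24_44_H2.{0})) :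
    ∀ p : ℕ, p.Prime → ∀ (k K : Type) [Field k] [CharP k p] [Field K] [Algebra k K]
      (O : ValuationSubring K) (A R : Subalgebra k K) (m₀ : ℕ), SandwichCtx O A R m₀ →
      ∀ m : ℕ, m₀ + 1 ≤ m → ∀ S : Subalgebra k K, tower O A m ≤ S → IsRegularLocalRing ↥S →
        (Ideal.span {s : ↥S | (s : K) ∈ ca (tower O A m)}).IsPrincipal := by
  intro p hp k K _ _ _ _ O A R m₀ ctx m hm S hTS hS
  obtain ⟨hk, hA, hfr, hAO, htr, -, -, -, -, -⟩ := id ctx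
  haveI := hS
  by_cases hreg : IsRegularLocalRing ↥(tower O A m)
  · rw [span_ca_eq_top_of_isRegularLocalRing O A hk hA hfr hAO m hreg S hTS]
    exact ⟨⟨1, by simp⟩⟩
  by_cases hdom : ∀ t : K, t ∈ tower O A m → t⁻¹ ∈ S → t⁻¹ ∈ tower O A m
  · exact caPrincipalUpstairsCore hF p hp k K O A R m₀ ctx m hm hreg S hTS hS hdom
  push Not at hdom
  obtain ⟨t, htT, htS, htnot⟩ := hdom
  have ht0 : t ≠ 0 := by
    rintro rfl
    exact htnot (by rw [inv_zero]; exact (tower O A m).zero_mem)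
  obtain ⟨n, rfl⟩ : ∃ n, m = n + 1 := ⟨m - 1, by omega⟩
  refine isPrincipal_span_ca_of_not_dominates O A hk hA hfr hAO htr.le n S hTS
    ⟨⟨t, htT⟩, fun hu => htnot ?_, ?_⟩
  · exact inv_mem_of_isUnit hu
  · exact isUnit_of_inv_mem (s := Subalgebra.inclusion hTS ⟨t, htT⟩) ht0 htS

/-! ## The sandwiched core and the rank-one surface kernel (registry ll. 2782–2821) -/

/-- **SANDWICHED TOWERS TERMINATE (`Sig.stub_sandwichedTerminationCore`, PROVED modulo the six facts).**  Strong induction on the number of base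
points of the stage over the regular `R` (S1 `stub_basePtsFinite` finiteness, S2 `stub_regularOfBasePtsEmpty`, S3 `caPrincipalUpstairs`,
S4 `stub_basePtsStrictAnti`).  The kernel clauses are introduced and NOT used; NO `StrictDrop`, NO `PersistenceRadical`.
[OURS; registry `sandwichedTerminationCore_of_cluster`] -/
theorem sandwichedTerminationCore (hF : (Literature.AlgebraicGeometry.Resolution.CossartJannsenSaito2020General.{0} ∧ Literature.AlgebraicGeometry.Resolution.Lipman1969_1_2.{0} ∧ Literature.AlgebraicGeometry.Resolution.Lipman1969_4_1.{0} ∧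
    Literature.AlgebraicGeometry.Resolution.Lipman1969_12_1_i.{0} ∧ Literature.AlgebraicGeometry.Resolution.Lipman1969_12_1_ii.{0} ∧
    Literature.AlgebraicGeometry.Morphisms.GortzWedhorn2023_24_44_H2.{0})) :
    ∀ p : ℕ, p.Prime → ∀ (k K : Type) [Field k] [CharP k p] [Field K]
      [Algebra k K] (O : ValuationSubring K) (A : Subalgebra k K), (∀ c : k, algebraMap k K c ∈ O) →
      A.FG → IsFractionRing ↥A K → A.toSubring ≤ O.toSubring →
      (∀ O' : ValuationSubring K,
        (∀ m : ℕ, ∀ s ∈ tower O A m, s ∈ O' ∧ (s⁻¹ ∈ O' → s⁻¹ ∈ O)) → ¬ IsNoetherianRing ↥O') →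
      (∀ O' : ValuationSubring K, O < O' → ∃ m : ℕ, ∃ s ∈ tower O A m, s⁻¹ ∈ O' ∧ s⁻¹ ∉ O) →
      (∀ O' : ValuationSubring K, O ≤ O' → O' = O ∨ O' = ⊤) →
      Algebra.trdeg k K = 2 →
      (∀ x : K, x ∈ O → ∃ m : ℕ, x ∈ tower O A m) →
      (∀ y : K, y ∈ O → ∃ f : Polynomial k, f ≠ 0 ∧ O.valuation (Polynomial.aeval y f) < 1) →
      ∀ R : Subalgebra k K, IsRegularLocalRing ↥R → IsFractionRing ↥R K →
        R.toSubring ≤ O.toSubring → loc O R = R →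
        ∀ m₀ : ℕ, (∀ m : ℕ, m₀ ≤ m → R ≤ tower O A m) →
      ∃ m : ℕ, IsRegularLocalRing ↥(tower O A m) := by
  intro p hp k K _ _ _ _ O A hk hA hfr hAO _hker _hmax _hrk htr _hexh _hzero R hR hRfr hRO hlocR m₀ hm₀
  have ctx : SandwichCtx O A R m₀ := ⟨hk, hA, hfr, hAO, htr, hR, hRfr, hRO, hlocR, hm₀⟩
  suffices key : ∀ n : ℕ, ∀ m : ℕ, m₀ + 1 ≤ m → (basePts R (tower O A m)).ncard = n →
      ∃ m' : ℕ, IsRegularLocalRing ↥(tower O A m') from key _ (m₀ + 1) le_rfl rfl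
  intro n
  induction n using Nat.strong_induction_on with
  | _ n ih =>
    intro m hm hn
    rcases (basePts R (tower O A m)).eq_empty_or_nonempty with hempty | hne
    · exact ⟨m, stub_regularOfBasePtsEmpty p hp k K O A R m₀ ctx m hm hempty⟩
    · by_cases hreg : IsRegularLocalRing ↥(tower O A (m + 1))
      · exact ⟨m + 1, hreg⟩
      · have hfin : (basePts R (tower O A m)).Finite := stub_basePtsFinite p hp k K O A R m₀ ctx m hm
        have hss : basePts R (tower O A (m + 1)) ⊂ basePts R (tower O A m) :=
          stub_basePtsStrictAnti p hp k K O A R m₀ ctx m hm (caPrincipalUpstairs hF p hp k K O A R m₀ ctx m hm) hne hreg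
        have hlt : (basePts R (tower O A (m + 1))).ncard < n := by
          rw [← hn]; exact Set.ncard_lt_ncard hss hfin
        exact ih _ hlt (m + 1) (by omega) rfl

/-- **THE RANK-ONE SURFACE KERNEL TERMINATES — WITHOUT `StrictDrop` (registry `Sig.stub_kernelRankOneSurface` with its unused
`PersistenceRadical → StrictDrop →` prefix DROPPED; PROVED modulo the six facts).**  Surface local uniformization (from CJS,
`stub_surfaceLU_of_cossartJannsenSaito2020`) and exhaustion supply the sandwich datum (`exh_exists_regular_le_tower_of_isLocallyUniformizable`);
`sandwichedTerminationCore` terminates it. [OURS; registry `kernelRankOneSurface_of_sandwich`] -/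
theorem kernelRankOneSurface_terminates (hF : (Literature.AlgebraicGeometry.Resolution.CossartJannsenSaito2020General.{0} ∧ Literature.AlgebraicGeometry.Resolution.Lipman1969_1_2.{0} ∧ Literature.AlgebraicGeometry.Resolution.Lipman1969_4_1.{0} ∧
    Literature.AlgebraicGeometry.Resolution.Lipman1969_12_1_i.{0} ∧ Literature.AlgebraicGeometry.Resolution.Lipman1969_12_1_ii.{0} ∧
    Literature.AlgebraicGeometry.Morphisms.GortzWedhorn2023_24_44_H2.{0})) :
    ∀ p : ℕ, p.Prime → ∀ (k K : Type) [Field k] [CharP k p] [Field K]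
      [Algebra k K] (O : ValuationSubring K) (A : Subalgebra k K), (∀ c : k, algebraMap k K c ∈ O) →
      A.FG → IsFractionRing ↥A K → A.toSubring ≤ O.toSubring →
      (∀ O' : ValuationSubring K,
        (∀ m : ℕ, ∀ s ∈ tower O A m, s ∈ O' ∧ (s⁻¹ ∈ O' → s⁻¹ ∈ O)) → ¬ IsNoetherianRing ↥O') →
      (∀ O' : ValuationSubring K, O < O' → ∃ m : ℕ, ∃ s ∈ tower O A m, s⁻¹ ∈ O' ∧ s⁻¹ ∉ O) →
      (∀ O' : ValuationSubring K, O ≤ O' → O' = O ∨ O' = ⊤) →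
      Algebra.trdeg k K = 2 →
      (∀ x : K, x ∈ O → ∃ m : ℕ, x ∈ tower O A m) →
      (∀ y : K, y ∈ O → ∃ f : Polynomial k, f ≠ 0 ∧ O.valuation (Polynomial.aeval y f) < 1) →
      ∃ m : ℕ, IsRegularLocalRing ↥(tower O A m) := by
  intro p hp k K _ _ _ _ O A hk hA hfr hAO hker hmax hrk htr hexh hzero
  haveI := hfr
  haveI : Algebra.FiniteType k ↥A := A.fg_iff_finiteType.mp hA
  have hfg : (⊤ : IntermediateField k K).FG := IntermediateField.fg_top_of_isFractionRing_of_finiteType k ↥A K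
  have hLU : IsLocallyUniformizable k K O :=
    stub_surfaceLU_of_cossartJannsenSaito2020 (CossartJannsenSaito2020General.cossartJannsenSaito2020_holds_of hF.1) k K hfg htr.le O hk
  obtain ⟨R, hRreg, hRfr, hRO, hRloc, m₀, hm₀⟩ := exh_exists_regular_le_tower_of_isLocallyUniformizable O A hk hAO hexh hLU
  exact sandwichedTerminationCore hF p hp k K O A hk hA hfr hAO hker hmax hrk htr hexh hzero R hRreg hRfr hRO hRloc m₀ hm₀

/-- **HONEST READING (with 2-Z): modulo the six facts there is NO rank-one exhausting zero-dimensional surface KERNEL datum** — every such tower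
terminates, and an exhausting kernel tower never terminates (`Exhaustion.not_isRegularLocalRing_of_exhaustive`).  So every surface `ca`-tower along a
rank-one valuation ring that it exhausts is weakly dominated by a NOETHERIAN valuation ring: the `StrictDrop`-dependence of `SurfaceTermination`
lies entirely in the noetherian-dominator and composite cases. [this work] -/
theorem no_kernelRankOneSurface (hF : (Literature.AlgebraicGeometry.Resolution.CossartJannsenSaito2020General.{0} ∧ Literature.AlgebraicGeometry.Resolution.Lipman1969_1_2.{0} ∧ Literature.AlgebraicGeometry.Resolution.Lipman1969_4_1.{0} ∧
    Literature.AlgebraicGeometry.Resolution.Lipman1969_12_1_i.{0} ∧ Literature.AlgebraicGeometry.Resolution.Lipman1969_12_1_ii.{0} ∧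
    Literature.AlgebraicGeometry.Morphisms.GortzWedhorn2023_24_44_H2.{0})) :
    ∀ p : ℕ, p.Prime → ∀ (k K : Type) [Field k] [CharP k p] [Field K]
      [Algebra k K] (O : ValuationSubring K) (A : Subalgebra k K), (∀ c : k, algebraMap k K c ∈ O) →
      A.FG → IsFractionRing ↥A K → A.toSubring ≤ O.toSubring →
      (∀ O' : ValuationSubring K,
        (∀ m : ℕ, ∀ s ∈ tower O A m, s ∈ O' ∧ (s⁻¹ ∈ O' → s⁻¹ ∈ O)) → ¬ IsNoetherianRing ↥O') →
      (∀ O' : ValuationSubring K, O < O' → ∃ m : ℕ, ∃ s ∈ tower O A m, s⁻¹ ∈ O' ∧ s⁻¹ ∉ O) →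
      (∀ O' : ValuationSubring K, O ≤ O' → O' = O ∨ O' = ⊤) →
      Algebra.trdeg k K = 2 →
      (∀ x : K, x ∈ O → ∃ m : ℕ, x ∈ tower O A m) →
      (∀ y : K, y ∈ O → ∃ f : Polynomial k, f ≠ 0 ∧ O.valuation (Polynomial.aeval y f) < 1) →
      False := by
  intro p hp k K _ _ _ _ O A hk hA hfr hAO hker hmax hrk htr hexh hzero
  exact Exhaustion.no_regular_stage_of_exhaustive O A hk hA hfr hAO hker hexh
    (kernelRankOneSurface_terminates hF p hp k K O A hk hA hfr hAO hker hmax hrk htr hexh hzero)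

end Summit.ResolutionOfSingularities.ResolutionOfSingularities.Theorems.SurfaceTermination.SandwichKernel

end
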